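import Mathlib
import Literature.Analysis.FluidPDE.TypeIICoreWitness
import Literature.Analysis.FluidPDE.LerayHopf
import Literature.Analysis.FluidPDE.ClassicalSolutionRescale
import Literature.Analysis.FluidPDE.IsometryInvariance
import Summits.NavierStokesRegularity.NavierStokesRegularity.Theorems.TypeIIInviscidRelaxationColumnarCoreExclusionCompactDatum
import Summits.NavierStokesRegularity.NavierStokesRegularity.Theorems.TypeIIInviscidRelaxationColumnarCoreExclusionPlanting
import Summits.NavierStokesRegularity.NavierStokesRegularity.Theorems.TypeIIInviscidRelaxationColumnarCoreExclusionTorusLaunch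
import HarnessLib

/-!
# Crux `ColumnarCoreExclusion` (stmt-NavierStokesRegularity-1966), line `columnar_comparison_flow`:
# the registered construction stub `stub_columnarComparisonFlow` BY NAME (universal constant `A = 3`)

`--supports stmt-NavierStokesRegularity-1966` (stub credit; theorems only, no definitions, no `sorry`).

Assembly of the comparison flow of the line card (skeleton `812bbbce6ea9853a`), signature verbatim:
1. the complete comparison DATUM `exists_compact_divFree_columnar_datum` (p829189: smooth, exactly divergence free,
   exactly columnar along the witness axis `Q e_z`, supported in the solid cylinder of radius `KL`, `3V/K`-close to
   `u(t)` on `ball x₀ (KL/2)`), read in the witness frame `Y = Q⁻¹(x − x₀)`;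
2. PLANTING on `𝕋²` (`exists_planted_torus_data`, p829806: rescale by `ℓ = 4KL`, centre at the cube centre, periodise;
   smooth, divergence-free torus data whose `2½`-dimensional field over `(q,0) + ℓ⁻¹Y` is `ℓ • g Y` on `‖Y_h‖ < ℓ/2`);
3. the 2½-dimensional LAUNCH (`exists_columnar_classicalNS_lift`, p829738: 2D Navier–Stokes on `𝕋²` — Ladyzhenskaya —
   plus the classical passive scalar for the vertical component, packaged by `isClassicalNSSolutionOn_twoHalf` and
   lifted to `ℝ³`): a global classical columnar bounded solution on `[0, τ] × ℝ³`, `τ = (T − t)/ℓ²`;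
4. the symmetries of the equations: parabolic rescaling `c = ℓ⁻¹` with time shift (`nsRescale_translate_zero`, Leray),
   conjugation by the witness rotation `Q` (`conj_linearIsometryEquiv`) and translation to `x₀` (`spaceTranslate`).
At time `t` the flow equals the datum on the half core ball, whence `‖u(t) − v(t)‖ ≤ 3V/K` there.

HONEST FRAMING: this closes the CONSTRUCTION stub of the line (tag M, print-backed); the research stubs
`stub_anchoredLateColumnarWitness` [L] and `stub_columnarShadowing` [XL] are untouched, and with them the crux
`ColumnarCoreExclusion` and everything above it.  Nothing about Navier–Stokes regularity is claimed.
-/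

noncomputable section

open Set Metric MeasureTheory Function
open Literature.Analysis Literature.Analysis.FunctionSpaces Literature.Analysis.FluidPDE
open Literature.Analysis.FunctionSpaces.Torus (twoHalf planarProj planarProjE planarEmbed lift proj)
open scoped InnerProductSpace ContDiff

namespace Summit.NavierStokesRegularity.NavierStokesRegularity.Theorems

-- the problem directory repeats the summit name (`NavierStokesRegularity/NavierStokesRegularity`)
set_option linter.dupNamespace false

namespace ColumnarComparisonFlow

open ColumnarComparisonDatum (exists_compact_divFree_columnar_datum isDivFree_comp_add)
open ColumnarComparisonPlanting (exists_planted_torus_data)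
open ColumnarComparisonLaunch (exists_columnar_classicalNS_lift)

/-- **The columnar comparison flow from a frame datum.**  Let `g : ℝ³ → ℝ³` be smooth, divergence free, columnar,
vanishing outside the cylinder `Y₀² + Y₁² ≤ ρ²` (`ρ > 0`), let `ν > 0`, `t < T`, `x₀ ∈ ℝ³` and `Q` a linear isometry.
Then there is a classical solution `(v, q)` of the unforced Navier–Stokes system on `[t, T] × ℝ³`, invariant under
translations along `Q e_z`, bounded, with `v t x = Q (g (Q⁻¹ (x − x₀)))` whenever `‖Q⁻¹(x − x₀)‖ < 2ρ`
(plant on `𝕋²` at scale `ℓ = 4ρ`, launch the 2½-dimensional flow, lift, rescale by `ℓ⁻¹`, rotate, translate).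
[cite: MajdaBertozziCUP2002, §2.3.1 Prop 2.7] -/
theorem exists_columnar_flow_of_frame_datum {g : EuclideanSpace ℝ (Fin 3) → EuclideanSpace ℝ (Fin 3)}
    (hg : ContDiff ℝ ∞ g) (hdiv : VectorCalculus.IsDivFree g) (hcol : IsColumnar g) {ρ : ℝ} (hρ : 0 < ρ)
    (h0 : ∀ Y : EuclideanSpace ℝ (Fin 3), ρ ^ 2 < Y 0 ^ 2 + Y 1 ^ 2 → g Y = 0)
    {ν t T : ℝ} (hν : 0 < ν) (htT : t < T) (x₀ : EuclideanSpace ℝ (Fin 3))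
    (Q : EuclideanSpace ℝ (Fin 3) ≃ₗᵢ[ℝ] EuclideanSpace ℝ (Fin 3)) :
    ∃ (v : ℝ → EuclideanSpace ℝ (Fin 3) → EuclideanSpace ℝ (Fin 3))
      (q : ℝ → EuclideanSpace ℝ (Fin 3) → ℝ) (Mv : ℝ),
      IsClassicalNSSolutionOn (Icc t T) ν 0 v q ∧
      (∀ (s : ℝ) (x : EuclideanSpace ℝ (Fin 3)) (τ : ℝ), v s (x + τ • Q eZ) = v s x) ∧
      (∀ s ∈ Icc t T, ∀ x, ‖v s x‖ ≤ Mv) ∧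
      (∀ x : EuclideanSpace ℝ (Fin 3), ‖Q.symm (x - x₀)‖ < 2 * ρ → v t x = Q (g (Q.symm (x - x₀)))) := by
  -- planting
  obtain ⟨qc, hqc⟩ : ∃ qc : EuclideanSpace ℝ (Fin 2), qc = WithLp.toLp 2 (fun _ : Fin 2 => (1 / 2 : ℝ)) := ⟨_, rfl⟩
  have hq : ∀ i, qc i = 1 / 2 := fun i => by simp [hqc]
  obtain ⟨V₀, R₀, hV₀, hV₀div, hR₀, hident⟩ := exists_planted_torus_data hg hdiv hcol hρ h0 hq
  -- launch
  set ℓ : ℝ := 4 * ρ with hℓ_def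
  have hℓ : 0 < ℓ := by positivity
  set c : ℝ := ℓ⁻¹ with hc_def
  have hc : 0 < c := inv_pos.2 hℓ
  have hc2 : 0 < c ^ 2 := by positivity
  set τ : ℝ := c ^ 2 * (T - t) with hτ_def
  have hτ : 0 < τ := mul_pos hc2 (sub_pos.2 htT)
  obtain ⟨u₁, p₁, hu₁, hu₁col, ⟨M₁, hM₁⟩, hu₁0⟩ := exists_columnar_classicalNS_lift hν hτ hV₀ hV₀div hR₀
  -- rescale (`c = ℓ⁻¹`, time shift `t₀ = -c² t`, centre over the cube centre)
  set P₀ : EuclideanSpace ℝ (Fin 3) := planarEmbed (qc, (0 : ℝ)) with hP₀_def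
  have hW₁ := hu₁.nsRescale_translate_zero hc (-(c ^ 2 * t)) P₀
  have hS : (fun r => -(c ^ 2 * t) + c ^ 2 * r) ⁻¹' Icc 0 τ = Icc t T := by
    ext r
    simp only [mem_preimage, mem_Icc, hτ_def]
    constructor
    · rintro ⟨h1, h2⟩; constructor <;> nlinarith [hc2]
    · rintro ⟨h1, h2⟩; constructor <;> nlinarith [hc2]
  rw [hS] at hW₁
  have hmemS : ∀ s ∈ Icc t T, -(c ^ 2 * t) + c ^ 2 * s ∈ Icc 0 τ := by
    intro s hs
    have : s ∈ (fun r => -(c ^ 2 * t) + c ^ 2 * r) ⁻¹' Icc 0 τ := by rw [hS]; exact hs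
    exact this
  -- rotate and translate
  have hW₂ := hW₁.conj_linearIsometryEquiv (R := Q) (uniqueDiffOn_Icc htT)
  have hW₃ := hW₂.spaceTranslate (-x₀)
  refine ⟨_, _, c * M₁, hW₃.congr_force fun s _ x => by simp, ?_, ?_, ?_⟩
  · -- columnar along `Q e_z`
    intro s x τ'
    show Q ((c • stPull (c ^ 2) c (-(c ^ 2 * t)) P₀ u₁) s (Q.symm (-x₀ + (x + τ' • Q eZ)))) =
      Q ((c • stPull (c ^ 2) c (-(c ^ 2 * t)) P₀ u₁) s (Q.symm (-x₀ + x)))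
    simp only [Pi.smul_apply, stPull_apply]
    congr 2
    rw [show -x₀ + (x + τ' • Q eZ) = (-x₀ + x) + τ' • Q eZ by abel, map_add, LinearIsometryEquiv.map_smul,
      LinearIsometryEquiv.symm_apply_apply, smul_add, smul_smul, ← add_assoc]
    exact hu₁col _ _ _
  · -- bounded
    intro s hs x
    show ‖Q ((c • stPull (c ^ 2) c (-(c ^ 2 * t)) P₀ u₁) s (Q.symm (-x₀ + x)))‖ ≤ c * M₁
    rw [LinearIsometryEquiv.norm_map]
    simp only [Pi.smul_apply, stPull_apply, norm_smul, Real.norm_eq_abs, abs_of_pos hc]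
    exact mul_le_mul_of_nonneg_left (hM₁ _ (hmemS s hs) _) hc.le
  · -- the initial slice on `‖Y‖ < 2ρ`
    intro x hx
    show Q ((c • stPull (c ^ 2) c (-(c ^ 2 * t)) P₀ u₁) t (Q.symm (-x₀ + x))) = Q (g (Q.symm (x - x₀)))
    simp only [Pi.smul_apply, stPull_apply]
    have e0 : -(c ^ 2 * t) + c ^ 2 * t = 0 := by ring
    have ex : -x₀ + x = x - x₀ := by abel
    rw [e0, ex, hu₁0]
    set Y : EuclideanSpace ℝ (Fin 3) := Q.symm (x - x₀) with hY_def
    have hYh : ‖planarProjE Y‖ < 4 * ρ / 2 :=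
      lt_of_le_of_lt (Torus.norm_planarProjE_le Y) (by linarith)
    have hid := hident Y hYh
    rw [hP₀_def, hc_def, hℓ_def, hid, smul_smul, inv_mul_cancel₀ (by positivity), one_smul]

/-- **Registered stub `stub_columnarComparisonFlow`** of the line `columnar_comparison_flow` (crux
`ColumnarCoreExclusion`, stmt-NavierStokesRegularity-1966; skeleton `812bbbce6ea9853a`), signature verbatim, with the
universal constant `A = 3`: from a level-`K ≥ 1` columnar core datum at time `t` of a classical solution `u` one builds
an EXACTLY COLUMNAR (along the witness axis `Q e_z`) classical Navier–Stokes solution `v` on `[t, T]`, bounded, with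
`‖u(t,x) − v(t,x)‖ ≤ 3V/K` on the half core ball `ball x₀ (KL/2)` — datum (p829189) + planting + 2½-dimensional launch
(2D Navier–Stokes and the advected–diffused vertical component, both global on `𝕋²`) + rescaling/rotation/translation
covariance.  The Leray–Hopf, decay, `0 < t` and Reynolds-number hypotheses are not used by the construction.
[cite: MajdaBertozziCUP2002, §2.3.1 Prop 2.7] [cite: Ladyzhenskaya1959, Thm. 1] -/
theorem stub_columnarComparisonFlow :
    ∃ A : ℝ, 0 < A ∧
      ∀ (ν T t K : ℝ) (u : ℝ → EuclideanSpace ℝ (Fin 3) → EuclideanSpace ℝ (Fin 3))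
        (p : ℝ → EuclideanSpace ℝ (Fin 3) → ℝ),
        0 < ν → 0 < T → IsClassicalNSSolutionOn (Ico 0 T) ν 0 u p → IsLerayHopfOn T ν 0 (u 0) u →
        HasRapidSpatialDecay (u 0) → 0 < t → t < T → 1 ≤ K →
        ∀ (x₀ : EuclideanSpace ℝ (Fin 3)) (L V : ℝ)
          (Q : EuclideanSpace ℝ (Fin 3) ≃ₗᵢ[ℝ] EuclideanSpace ℝ (Fin 3))
          (W : EuclideanSpace ℝ (Fin 3) → EuclideanSpace ℝ (Fin 3)),
          0 < L → 0 < V → IsColumnar W → (∀ x, ‖u t x‖ ≤ V) → K * ν ≤ L * V →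
          (∀ y : EuclideanSpace ℝ (Fin 3), ‖y‖ ≤ K →
            ‖V⁻¹ • Q.symm (u t (x₀ + L • Q y)) - W y‖ ≤ K⁻¹) →
          ∃ (v : ℝ → EuclideanSpace ℝ (Fin 3) → EuclideanSpace ℝ (Fin 3))
            (q : ℝ → EuclideanSpace ℝ (Fin 3) → ℝ) (Mv : ℝ),
            IsClassicalNSSolutionOn (Icc t T) ν 0 v q ∧
            (∀ s ∈ Icc t T, ∀ (x : EuclideanSpace ℝ (Fin 3)) (τ : ℝ), v s (x + τ • Q eZ) = v s x) ∧
            (∀ s ∈ Icc t T, ∀ x, ‖v s x‖ ≤ Mv) ∧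
            (∀ x ∈ ball x₀ (K * L / 2), ‖u t x - v t x‖ ≤ A * V / K) := by
  refine ⟨3, by norm_num, ?_⟩
  intro ν T t K u p hν _hT hns _hLH _hdec ht htT hK x₀ L V Q W hL hV hW hbd _hRe hclose
  have hK0 : 0 < K := lt_of_lt_of_le one_pos hK
  have hKL : 0 < K * L := mul_pos hK0 hL
  have ht_mem : t ∈ Ico 0 T := ⟨ht.le, htT⟩
  -- (1) the datum in physical coordinates
  obtain ⟨v₀, hv₀s, hv₀div, hv₀col, hv₀out, -, hv₀close⟩ :=
    exists_compact_divFree_columnar_datum u t (hns.contDiff_velocity ht_mem) (hns.divFree t ht_mem) x₀ L V K Q W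
      hL hV hK0 hW hbd hclose
  -- (2) its frame form
  set g : EuclideanSpace ℝ (Fin 3) → EuclideanSpace ℝ (Fin 3) := fun Y => Q.symm (v₀ (x₀ + Q Y)) with hg_def
  have hg : ContDiff ℝ ∞ g := Q.symm.contDiff.comp (hv₀s.comp (contDiff_const.add Q.contDiff))
  have hgdiv : VectorCalculus.IsDivFree g := by
    have h1 : VectorCalculus.IsDivFree fun y => v₀ (y + x₀) := isDivFree_comp_add hv₀div x₀
    have h2 := h1.conj_linearIsometryEquiv (R := Q.symm)
    refine fun y => ?_
    have := h2 y
    simpa [hg_def, add_comm] using this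
  have hgcol : IsColumnar g := by
    intro Y a
    show Q.symm (v₀ (x₀ + Q (Y + a • eZ))) = Q.symm (v₀ (x₀ + Q Y))
    rw [map_add, LinearIsometryEquiv.map_smul, ← add_assoc, hv₀col]
  have hg0 : ∀ Y : EuclideanSpace ℝ (Fin 3), (K * L) ^ 2 < Y 0 ^ 2 + Y 1 ^ 2 → g Y = 0 := by
    intro Y hY
    show Q.symm (v₀ (x₀ + Q Y)) = 0
    rw [hv₀out (x₀ + Q Y) (by simpa using hY), map_zero]
  -- (3)–(4) plant, launch, rescale, rotate, translate
  obtain ⟨v, q, Mv, hv, hvcol, hvbd, hvt⟩ :=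
    exists_columnar_flow_of_frame_datum hg hgdiv hgcol hKL hg0 hν htT x₀ Q
  refine ⟨v, q, Mv, hv, fun s _ x τ => hvcol s x τ, hvbd, fun x hx => ?_⟩
  have hY : ‖Q.symm (x - x₀)‖ < 2 * (K * L) := by
    rw [LinearIsometryEquiv.norm_map, ← dist_eq_norm]
    have := mem_ball.1 hx
    nlinarith
  rw [hvt x hY]
  have e : Q (g (Q.symm (x - x₀))) = v₀ x := by
    show Q (Q.symm (v₀ (x₀ + Q (Q.symm (x - x₀))))) = v₀ x
    rw [LinearIsometryEquiv.apply_symm_apply, LinearIsometryEquiv.apply_symm_apply, add_sub_cancel]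
  rw [e]
  simpa [div_eq_mul_inv, mul_comm, mul_assoc, mul_left_comm] using hv₀close x hx

end ColumnarComparisonFlow

end Summit.NavierStokesRegularity.NavierStokesRegularity.Theorems

end
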